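import Summits.KontsevichZagierPeriods.KontsevichZagierPeriods.Theorems.LinRedNormalFormArrangementNormalFormSeparateThreeHIReflect
import Summits.KontsevichZagierPeriods.KontsevichZagierPeriods.Theorems.LinRedNormalFormArrangementNormalFormSeparateThreeHIChart
import Summits.KontsevichZagierPeriods.KontsevichZagierPeriods.Theorems.LinRedNormalFormArrangementNormalFormSeparateSplit

/-!
# Termwise absolute convergence of the Taylor split in dimension three under the rim condition

(Line `janus-bands`, crux `ArrangementNormalForm`, stub `stub_separateThreeZero`, part `HIFinal`:
the dimension-3 fibre-free termwise-split lemma `separateThree_hI` = hypothesis `hHI₃` of the 3-d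
engine `SepThree.piece` / `SepThree.terminal`.)

Base dimension `3` (`b = 2`: base `(x₁, x₂, y)`), no fibres (`k = 0`). A terminal piece of the
far-first separation engine carries `P(x′, y)/∏ Lⱼ(x′)^{eⱼ} · (y − ℓ(x′))^{-n}` on a bounded open
polytope, absolutely convergent, with the RIM CONDITION `hR`: an active `x′`-letter vanishes at a
point of the closed polytope only on the pole plane `y = ℓ(x′)` (with `n ≠ 0`) or where the closed
vertical fibre is non-degenerate. CLAIM: every Taylor piece
`qᵢ(x′) (y − ℓ)^{i−n}/∏ Lⱼ^{eⱼ}` is absolutely integrable on the polytope. Proof: the vertical shear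
chart `chart3` (part `HIChart`) turns the data into a polyhedral cell over the base plane with the
pole plane `w = 0`, and `SepThree.core` (parts `HICore`, `HIReflect`: column lemma at every base
point — bounded pieces, fixed intervals, thick fibres and the brick, the rim vertex by directions
and power counting — and compactness) applies. Degenerate letters (`Lⱼ ≡ 0` active) make every
piece vanish identically.
-/

noncomputable section

open Set MeasureTheory Filter Topology
open scoped ENNReal

namespace Summit.KontsevichZagierPeriods.ArrangementNormalForm.JanusBands

open Literature.NumberTheory.Transcendental

namespace SepThree

/-! ### Coordinate dictionary of `Fin (2 + 1 + 0) → ℝ` with the chart -/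

/-- An `x′`-form in coordinates. -/
theorem xform_eq (c : (Fin 2 → ℚ) × ℚ) (z : Fin (2 + 1 + 0) → ℝ) :
    (∑ i, (c.1 i : ℝ) * z (Fin.castAdd 0 (Fin.castSucc i)) + (c.2 : ℝ)) =
      (c.1 0 : ℝ) * bse z 0 + (c.1 1 : ℝ) * bse z 1 + c.2 := by
  rw [Fin.sum_univ_two]; rfl

/-- A full-base form in coordinates. -/
theorem zform_eq (c : (Fin (2 + 1) → ℚ) × ℚ) (z : Fin (2 + 1 + 0) → ℝ) :
    (∑ i, (c.1 i : ℝ) * z (Fin.castAdd 0 i) + (c.2 : ℝ)) =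
      (c.1 0 : ℝ) * bse z 0 + (c.1 1 : ℝ) * bse z 1 + (c.1 2 : ℝ) * z (Fin.last 2) + c.2 := by
  rw [Fin.sum_univ_three]; rfl

/-- The `x′`-part of a point. -/
theorem xpart_eq3 (z : Fin (2 + 1 + 0) → ℝ) :
    (fun i : Fin 2 => z (Fin.castAdd 0 (Fin.castSucc i))) = bse z := rfl

/-- The distinguished coordinate. -/
theorem ycoord_eq (z : Fin (2 + 1 + 0) → ℝ) : z (Fin.castAdd 0 (Fin.last 2)) = z (Fin.last 2) := rfl

/-- Without fibres the fibre block is `1`. -/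
theorem fblock_eq (a : Fin 0 → Option ((Fin (2 + 1) → ℚ) × ℚ)) (z : Fin (2 + 1 + 0) → ℝ) :
    (∏ i, (a i).elim 1 (fun c => 1 / (z (Fin.natAdd (2 + 1) i) -
      (∑ i', (c.1 i' : ℝ) * z (Fin.castAdd 0 i') + (c.2 : ℝ))))) = 1 := by
  simp

/-- Rational polynomials on the base plane read as real polynomials. -/
theorem aeval_eq_Qv (q : ℕ → MvPolynomial (Fin 2) ℚ) (i : ℕ) (v : Fin 2 → ℝ) :
    MvPolynomial.aeval v (q i) = Qv (fun i => MvPolynomial.map (algebraMap ℚ ℝ) (q i)) i v := by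
  rw [Qv, MvPolynomial.eval_map, MvPolynomial.aeval_def]

end SepThree

open SepThree in
/-- **Termwise absolute convergence of the Taylor split in dimension three under the rim
condition** (`separateThree_hI`, the hypothesis `hHI₃` of the 3-d engine; registered part of
`stub_separateThreeZero`): see the module docstring. -/
theorem separateThree_hI (b k m m' n : ℕ) (s : KZ.IntegralRep (b + 1 + k)) (M : Fin m' → (Fin (b + 1) → ℚ) × ℚ) (L : Fin m → (Fin b → ℚ) × ℚ) (e : Fin m → ℕ) (p : MvPolynomial (Fin (b + 1)) ℚ) (ℓ : (Fin b → ℚ) × ℚ) (a : Fin k → Option ((Fin (b + 1) → ℚ) × ℚ)) (lo hi : Fin k → Fin k ⊕ ((Fin (b + 1) → ℚ) × ℚ)) (hpole : n ≠ 0 → ∀ z ∈ s.domain, (z (Fin.castAdd k (Fin.last b)) - (∑ i, (ℓ.1 i : ℝ) * z (Fin.castAdd k (Fin.castSucc i)) + (ℓ.2 : ℝ))) ≠ 0) (hbd : Bornology.IsBounded s.domain) (hdom : s.domain = {z | (∀ j, 0 < ∑ i, ((M j).1 i : ℝ) * z (Fin.castAdd k i) + ((M j).2 : ℝ)) ∧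 ∀ i, Sum.elim (fun j => z (Fin.natAdd (b + 1) j)) (fun c => ∑ i', (c.1 i' : ℝ) * z (Fin.castAdd k i') + (c.2 : ℝ)) (lo i) < z (Fin.natAdd (b + 1) i) ∧ z (Fin.natAdd (b + 1) i) < Sum.elim (fun j => z (Fin.natAdd (b + 1) j)) (fun c => ∑ i', (c.1 i' : ℝ) * z (Fin.castAdd k i') + (c.2 : ℝ)) (hi i)}) (hint : EqOn s.integrand (fun z => MvPolynomial.aeval (fun i => z (Fin.castAdd k i)) p / (∏ j, (∑ i, ((L j).1 i : ℝ) * z (Fin.castAdd k (Fin.castSucc i)) + ((L j).2 : ℝ)) ^ e j) * (1 / (z (Fin.castAdd k (Fin.last b)) - (∑ i, (ℓ.1 i : ℝ) * z (Fin.castAdd k (Fin.castSucc i)) + (ℓ.2 : ℝ))) ^ n) * ∏ i, (a i).elim 1 (fun c => 1 / (z (Fin.natAdd (b + 1) i) - (∑ i', (c.1 i' : ℝ) * z (Fin.castAdd k i') + (c.2 : ℝ))))) s.domain) (N : ℕ) (q : ℕ → MvPolynomial (Fin b) ℚ) (hq : ∀ z : Fin (b + 1 + k) → ℝ, MvPolynomial.aeval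 (fun i => z (Fin.castAdd k i)) p = ∑ i ∈ Finset.range N, MvPolynomial.aeval (fun i => z (Fin.castAdd k (Fin.castSucc i))) (q i) * (z (Fin.castAdd k (Fin.last b)) - (∑ i, (ℓ.1 i : ℝ) * z (Fin.castAdd k (Fin.castSucc i)) + (ℓ.2 : ℝ))) ^ i) (hb : b = 2) (hk : k = 0) (hR : ∀ z ∈ closure s.domain, (∃ j, e j ≠ 0 ∧ (∑ i, ((L j).1 i : ℝ) * z (Fin.castAdd k (Fin.castSucc i)) + ((L j).2 : ℝ)) = 0) → (n ≠ 0 ∧ z (Fin.castAdd k (Fin.last b)) = ∑ i, (ℓ.1 i : ℝ) * z (Fin.castAdd k (Fin.castSucc i)) + (ℓ.2 : ℝ)) ∨ (∃ z' ∈ closure s.domain, z' ≠ z ∧ ∀ i : Fin b, z' (Fin.castAdd k (Fin.castSucc i)) = z (Fin.castAdd k (Fin.castSucc i)))) : ∀ i ∈ Finset.range N, IntegrableOn (fun z => MvPolynomial.aeval (fun i => z (Fin.castAdd k (Fin.castSucc i))) (q i) / (∏ j, (∑ i, ((L j).1 i : ℝ) * z (Fin.castAdd k (Fin.castSucc i))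 + ((L j).2 : ℝ)) ^ e j) * ((z (Fin.castAdd k (Fin.last b)) - (∑ i, (ℓ.1 i : ℝ) * z (Fin.castAdd k (Fin.castSucc i)) + (ℓ.2 : ℝ))) ^ i / (z (Fin.castAdd k (Fin.last b)) - (∑ i, (ℓ.1 i : ℝ) * z (Fin.castAdd k (Fin.castSucc i)) + (ℓ.2 : ℝ))) ^ n) * ∏ i, (a i).elim 1 (fun c => 1 / (z (Fin.natAdd (b + 1) i) - (∑ i', (c.1 i' : ℝ) * z (Fin.castAdd k i') + (c.2 : ℝ))))) s.domain := by
  subst hb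
  subst hk
  intro i hiN
  classical
  have hiN' : i < N := Finset.mem_range.1 hiN
  -- degenerate letters: an active letter that is identically zero kills every piece
  by_cases hdeg : ∃ j, e j ≠ 0 ∧ (L j).1 0 = 0 ∧ (L j).1 1 = 0 ∧ (L j).2 = 0
  · obtain ⟨j, hej, h0, h1, h2⟩ := hdeg
    have hW : ∀ z : Fin (2 + 1 + 0) → ℝ,
        (∏ j, (∑ i, ((L j).1 i : ℝ) * z (Fin.castAdd 0 (Fin.castSucc i)) + ((L j).2 : ℝ)) ^ e j) = 0 :=
      fun z => Finset.prod_eq_zero (Finset.mem_univ j) (by rw [xform_eq, h0, h1, h2]; simp [hej])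
    refine (integrableOn_zero : IntegrableOn (fun _ => (0 : ℝ)) s.domain).congr
      (Eventually.of_forall fun z => ?_)
    show (0 : ℝ) = _
    rw [hW z, div_zero, zero_mul, zero_mul]
  push Not at hdeg
  -- the chart data
  set l : ℝ × ℝ × ℝ := ((ℓ.1 0 : ℝ), (ℓ.1 1 : ℝ), (ℓ.2 : ℝ)) with hl
  set Ψ := (chart3 l).symm with hΨ
  have hΨmp : MeasurePreserving Ψ volume volume := (measurePreserving_chart3 l).symm _
  have hΨemb : MeasurableEmbedding Ψ := (chart3 l).symm.measurableEmbedding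
  have hb0 : ∀ q : (Fin 2 → ℝ) × ℝ, bse (Ψ q) 0 = q.1 0 := fun q => congrFun (bse_chart3_symm l q) 0
  have hb1 : ∀ q : (Fin 2 → ℝ) × ℝ, bse (Ψ q) 1 = q.1 1 := fun q => congrFun (bse_chart3_symm l q) 1
  have hbb : ∀ q : (Fin 2 → ℝ) × ℝ, bse (Ψ q) = q.1 := fun q => bse_chart3_symm l q
  have hla : ∀ q : (Fin 2 → ℝ) × ℝ, Ψ q (Fin.last 2) = q.2 + affv l q.1 := fun q => last_chart3_symm l q
  have hℓ : ∀ q : (Fin 2 → ℝ) × ℝ, (∑ i, (ℓ.1 i : ℝ) * Ψ q (Fin.castAdd 0 (Fin.castSucc i)) + (ℓ.2 : ℝ)) =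
      affv l q.1 := fun q => by rw [xform_eq, hb0, hb1]; simp [affv, hl]
  have hw : ∀ q : (Fin 2 → ℝ) × ℝ, Ψ q (Fin.castAdd 0 (Fin.last 2)) -
      (∑ i, (ℓ.1 i : ℝ) * Ψ q (Fin.castAdd 0 (Fin.castSucc i)) + (ℓ.2 : ℝ)) = q.2 := fun q => by
    rw [hℓ, show Ψ q (Fin.castAdd 0 (Fin.last 2)) = Ψ q (Fin.last 2) from rfl, hla]; ring
  -- the cell
  set g : Fin m' → Con := fun j => (![((M j).1 0 : ℝ) + (M j).1 2 * ℓ.1 0, ((M j).1 1 : ℝ) + (M j).1 2 * ℓ.1 1],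
    ((M j).1 2 : ℝ), ((M j).1 2 : ℝ) * ℓ.2 + (M j).2) with hg
  have hcv : ∀ (j : Fin m') (q : (Fin 2 → ℝ) × ℝ),
      (∑ i, ((M j).1 i : ℝ) * Ψ q (Fin.castAdd 0 i) + ((M j).2 : ℝ)) = cval (g j) q := fun j q => by
    rw [zform_eq, hb0, hb1, hla]
    simp only [cval, hg, affv, hl, Matrix.cons_val_zero, Matrix.cons_val_one]
    ring
  have hΩ : Ψ ⁻¹' s.domain = Om3 g := by
    ext q
    rw [hdom]
    simp only [mem_preimage, mem_setOf_eq, Om3, hcv, IsEmpty.forall_iff, and_true]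
  -- the letters and the numerator
  set κ : Fin m → Fin 2 → ℝ := fun j => ![((L j).1 0 : ℝ), ((L j).1 1 : ℝ)] with hκ
  set μ : Fin m → ℝ := fun j => ((L j).2 : ℝ) with hμ
  set qr : ℕ → MvPolynomial (Fin 2) ℝ := fun i => MvPolynomial.map (algebraMap ℚ ℝ) (q i) with hqr
  have hlv : ∀ (j : Fin m) (q' : (Fin 2 → ℝ) × ℝ),
      (∑ i, ((L j).1 i : ℝ) * Ψ q' (Fin.castAdd 0 (Fin.castSucc i)) + ((L j).2 : ℝ)) = lval κ μ j q'.1 :=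
    fun j q' => by rw [xform_eq, hb0, hb1]; simp [lval, hκ, hμ]
  have hWt : ∀ q' : (Fin 2 → ℝ) × ℝ,
      (∏ j, (∑ i, ((L j).1 i : ℝ) * Ψ q' (Fin.castAdd 0 (Fin.castSucc i)) + ((L j).2 : ℝ)) ^ e j) =
        Wt κ μ e q'.1 := fun q' => by simp only [Wt, hlv]
  have hQ : ∀ (i : ℕ) (q' : (Fin 2 → ℝ) × ℝ),
      MvPolynomial.aeval (fun i => Ψ q' (Fin.castAdd 0 (Fin.castSucc i))) (q i) = Qv qr i q'.1 :=
    fun i q' => by rw [xpart_eq3, hbb, aeval_eq_Qv]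
  -- the integrand in the chart
  have hF : ∀ q' ∈ Om3 g, s.integrand (Ψ q') = Fform κ μ e N qr n q' := by
    intro q' hq'
    have hmem : Ψ q' ∈ s.domain := by rw [← mem_preimage, hΩ]; exact hq'
    rw [hint hmem]
    simp only []
    rw [hq (Ψ q'), fblock_eq a (Ψ q'), mul_one, hWt q']
    simp only [hQ, hw, Fform, psum, one_div_pow]
  have hintΩ : IntegrableOn (Fform κ μ e N qr n) (Om3 g) := by
    have h1 := (hΨmp.integrableOn_comp_preimage hΨemb).2 s.integrableOn
    rw [hΩ] at h1
    exact h1.congr_fun (fun q' hq' => hF q' hq') (measurableSet_Om3 g)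
  -- boundedness, pole condition, non-degeneracy, rim condition in the chart
  have hbdΩ : Bornology.IsBounded (Om3 g) := by
    obtain ⟨r, hr⟩ := hbd.subset_closedBall 0
    rw [← hΩ]
    refine isBounded_iff_forall_norm_le.2 ⟨|r| + (|r| + ((|l.1| + |l.2.1|) * |r| + |l.2.2|)), fun q' hq' => ?_⟩
    have hz : ‖Ψ q'‖ ≤ |r| := by
      have := hr hq'
      rw [Metric.mem_closedBall, dist_zero_right] at this
      exact this.trans (le_abs_self r)
    have hc : ∀ i', |Ψ q' i'| ≤ |r| := fun i' =>
      le_trans (by rw [← Real.norm_eq_abs]; exact norm_le_pi_norm _ i') hz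
    have hv0 : |q'.1 0| ≤ |r| := by rw [← hb0]; exact hc _
    have hv1 : |q'.1 1| ≤ |r| := by rw [← hb1]; exact hc _
    have h1 : ‖q'.1‖ ≤ |r| := by
      refine (pi_norm_le_iff_of_nonneg (abs_nonneg r)).2 fun i' => ?_
      rw [Real.norm_eq_abs]
      fin_cases i'
      · exact hv0
      · exact hv1
    have h2 : |q'.2| ≤ |r| + ((|l.1| + |l.2.1|) * |r| + |l.2.2|) := by
      have e2 : q'.2 = Ψ q' (Fin.last 2) - affv l q'.1 := by rw [hla]; ring
      rw [e2, affv]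
      have hA : |l.1 * q'.1 0 + l.2.1 * q'.1 1 + l.2.2| ≤ (|l.1| + |l.2.1|) * |r| + |l.2.2| := by
        calc |l.1 * q'.1 0 + l.2.1 * q'.1 1 + l.2.2|
            ≤ |l.1 * q'.1 0| + |l.2.1 * q'.1 1| + |l.2.2| := abs_add_three _ _ _
          _ = |l.1| * |q'.1 0| + |l.2.1| * |q'.1 1| + |l.2.2| := by rw [abs_mul, abs_mul]
          _ ≤ |l.1| * |r| + |l.2.1| * |r| + |l.2.2| := by gcongr
          _ = (|l.1| + |l.2.1|) * |r| + |l.2.2| := by ring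
      calc |Ψ q' (Fin.last 2) - (l.1 * q'.1 0 + l.2.1 * q'.1 1 + l.2.2)|
          ≤ |Ψ q' (Fin.last 2)| + |l.1 * q'.1 0 + l.2.1 * q'.1 1 + l.2.2| := abs_sub _ _
        _ ≤ |r| + ((|l.1| + |l.2.1|) * |r| + |l.2.2|) := add_le_add (hc _) hA
    rw [Prod.norm_def, Real.norm_eq_abs]
    refine max_le (h1.trans ?_) (h2.trans ?_)
    · exact le_add_of_nonneg_right (by positivity)
    · exact le_add_of_nonneg_left (abs_nonneg r)
  have hpoleΩ : n ≠ 0 → ∀ q' ∈ Om3 g, q'.2 ≠ 0 := fun hn q' hq' => by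
    have hmem : Ψ q' ∈ s.domain := by rw [← mem_preimage, hΩ]; exact hq'
    have := hpole hn _ hmem
    rwa [hw] at this
  have hnd : ∀ j, e j ≠ 0 → ¬(κ j = 0 ∧ μ j = 0) := by
    rintro j hej ⟨hκ0, hμ0⟩
    have h0 : ((L j).1 0 : ℝ) = 0 := by have := congrFun hκ0 0; simpa [hκ] using this
    have h1 : ((L j).1 1 : ℝ) = 0 := by have := congrFun hκ0 1; simpa [hκ] using this
    exact hdeg j hej (by exact_mod_cast h0) (by exact_mod_cast h1) (by simpa [hμ] using hμ0)
  have hclΩ : closure (Om3 g) = Ψ ⁻¹' closure s.domain := by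
    rw [← hΩ]; exact (chart3_symm_preimage_closure l s.domain).symm
  have hRimΩ : ∀ q' ∈ closure (Om3 g), (∃ j, e j ≠ 0 ∧ lval κ μ j q'.1 = 0) →
      (n ≠ 0 ∧ q'.2 = 0) ∨ ∃ q'' ∈ closure (Om3 g), q'' ≠ q' ∧ q''.1 = q'.1 := by
    intro q' hq' hj
    rw [hclΩ] at hq'
    obtain ⟨j, hej, hjv⟩ := hj
    rcases hR (Ψ q') hq' ⟨j, hej, by rw [hlv]; exact hjv⟩ with ⟨hn, heq⟩ | ⟨z', hz', hne, hbase⟩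
    · left
      refine ⟨hn, ?_⟩
      have := hw q'
      rw [heq, sub_self] at this
      exact this.symm
    · right
      refine ⟨chart3 l z', ?_, fun heq => hne ?_, ?_⟩
      · rw [hclΩ, mem_preimage, hΨ, MeasurableEquiv.symm_apply_apply]; exact hz'
      · rw [← heq, hΨ, MeasurableEquiv.symm_apply_apply]
      · rw [chart3_apply]
        show bse z' = q'.1
        rw [← hbb q']
        funext i'
        exact hbase i'
  -- the core theorem in the chart, and back
  have hcore := core g κ μ e N qr n hbdΩ hpoleΩ hintΩ hnd hRimΩ i hiN'
  rw [← hΩ] at hcore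
  have hpiece : (fun z => MvPolynomial.aeval (fun i => z (Fin.castAdd 0 (Fin.castSucc i))) (q i) /
      (∏ j, (∑ i, ((L j).1 i : ℝ) * z (Fin.castAdd 0 (Fin.castSucc i)) + ((L j).2 : ℝ)) ^ e j) *
      ((z (Fin.castAdd 0 (Fin.last 2)) - (∑ i, (ℓ.1 i : ℝ) * z (Fin.castAdd 0 (Fin.castSucc i)) + (ℓ.2 : ℝ))) ^ i /
        (z (Fin.castAdd 0 (Fin.last 2)) - (∑ i, (ℓ.1 i : ℝ) * z (Fin.castAdd 0 (Fin.castSucc i)) + (ℓ.2 : ℝ))) ^ n) *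
      ∏ i, (a i).elim 1 (fun c => 1 / (z (Fin.natAdd (2 + 1) i) -
        (∑ i', (c.1 i' : ℝ) * z (Fin.castAdd 0 i') + (c.2 : ℝ))))) ∘ Ψ = tpiece κ μ e qr n i := by
    funext q'
    simp only [Function.comp, fblock_eq, mul_one, hWt, hQ, hw, tpiece]
  exact (hΨmp.integrableOn_comp_preimage hΨemb).1 (hpiece ▸ hcore)

end Summit.KontsevichZagierPeriods.ArrangementNormalForm.JanusBands
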